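import Mathlib
import Literature.Analysis.FunctionSpaces.TorusHNegOneDerivative
import Literature.Analysis.FunctionSpaces.TorusSpectralWeakDerivative
import Literature.Analysis.FunctionSpaces.TorusFourierCalculus
import Literature.Analysis.FunctionSpaces.TorusFourierModes
import Literature.Analysis.FunctionSpaces.TorusEnstrophyTrilinear
import Summits.NavierStokesRegularity.FluidComputer.CubeShellAdjacency
import HarnessLib

/-!
# Poincaré inequalities for fields with a frequency cutoff at an arbitrary level `M`, and the cube tail (cap g5, cell `ns-blowup`, 2026-08-26)

HONEST FRAMING (human ruling D-0035): nothing here is a claim about Navier–Stokes blow-up.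
WHAT THIS IS NOT: not NS evidence. `HighModePoincare` (instab, p408616) gives the three high-mode
Poincaré inequalities for fields with `fourierTruncate N w = 0`, i.e. no modes in the BALL `|k|² ≤ N²`
(`N : ℕ`), constant `4π²(N² + 1)`. The certificates of the cell cut their tails on CUBE shells
`|k|_∞ ≥ K + 1`, whose sharp constant is `4π²(K+1)²`; since `(K+1)² − 1` is not a square, the ball
lemmas only reach `4π²((K+1)² − 2K)` there (cap g5 ERRATUM, STATUS ≈ l.3220). This file proves the
Poincaré inequalities under the general hypothesis «`𝓕w(k) = 0` whenever `|k|² < M`» for ANY real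
`M ≥ 0` (Parseval + the spectral form of `‖∇w‖₂²`), transfers that hypothesis to `∂ⱼw` and `Δw`, and
supplies the cube-tail link `M = (K+1)²`:

* `integral_norm_sq_le_of_coeff_eq_zero` — `4π²M ∫‖w‖² ≤ ‖∇w‖₂²`;
* `gradNormSq_le_of_coeff_eq_zero` — `4π²M ‖∇w‖₂² ≤ ‖Δw‖₂²`;
* `integral_norm_laplacian_sq_le_of_coeff_eq_zero` — `4π²M ‖Δw‖₂² ≤ ‖∇Δw‖₂²`;
* `coeff_partialDeriv_eq_zero`, `coeff_laplacian_eq_zero` — the cutoff is inherited by derivatives;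
* `coeff_eq_zero_of_cube_tail` — if `𝓕w(k) = 0` unless some `|kᵢ| ≥ K + 1`, then `𝓕w(k) = 0` for
  `|k|² < (K+1)²` (`CubeShellAdjacency.sq_le_sum_sq_of_exists_abs_ge_real`).

Mathlib + the tree's torus Fourier calculus; no new definitions.
-/

noncomputable section

namespace Summit.NavierStokesRegularity.FluidComputer.FrequencyCutoffPoincare

open Literature.Analysis.FunctionSpaces Literature.Analysis.FunctionSpaces.Torus MeasureTheory
open UnitAddTorus
open scoped ENNReal

variable {d : Type*} [Fintype d] [DecidableEq d]

/-- **Frequency-cutoff Poincaré.** If the Fourier coefficients of a smooth real field `w` vanish at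
every frequency with `|k|² < M` (`M ≥ 0` real), then `4π²M·∫‖w‖² ≤ ‖∇w‖₂²` (`gradNormSq`).
Parseval and `‖∇w‖₂² = 4π² Σ |k|²‖ŵ(k)‖²`, compared term by term. -/
theorem integral_norm_sq_le_of_coeff_eq_zero {w : UnitAddTorus d → EuclideanSpace ℝ d}
    (hw : IsSmooth w) {M : ℝ} (hM : 0 ≤ M)
    (h : ∀ k : d → ℤ, freqNormSq k < M → mFourierCoeff (EuclideanSpace.complexify ∘ w) k = 0) :
    4 * Real.pi ^ 2 * M * ∫ x, ‖w x‖ ^ 2 ≤ gradNormSq w := by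
  have hint0 : 0 ≤ ∫ x, ‖w x‖ ^ 2 := integral_nonneg fun x => sq_nonneg _
  -- the comparison in ℝ≥0∞
  have hE : ENNReal.ofReal (4 * Real.pi ^ 2 * M * ∫ x, ‖w x‖ ^ 2) ≤ eGradNormSq w := by
    rw [ENNReal.ofReal_mul (by positivity), ← tsum_enorm_sq_mFourierCoeff_complexify_eq_ofReal hw.continuous,
      ENNReal.ofReal_mul (by positivity), eGradNormSq_eq_tsum, mul_assoc, ← ENNReal.tsum_mul_left]
    refine mul_le_mul_right (ENNReal.tsum_le_tsum fun k => ?_) _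
    by_cases hk : freqNormSq k < M
    · rw [h k hk]; simp
    · exact mul_le_mul_left (ENNReal.ofReal_le_ofReal (not_lt.mp hk)) _
  rw [eGradNormSq_eq_ofReal_gradNormSq hw] at hE
  exact (ENNReal.ofReal_le_ofReal_iff (gradNormSq_nonneg w)).mp hE

/-- The cutoff is inherited by partial derivatives: `𝓕(∂ⱼw)(k) = 2πikⱼ·𝓕w(k)`. -/
theorem coeff_partialDeriv_eq_zero {w : UnitAddTorus d → EuclideanSpace ℝ d} (hw : IsSmooth w)
    {M : ℝ} (h : ∀ k : d → ℤ, freqNormSq k < M → mFourierCoeff (EuclideanSpace.complexify ∘ w) k = 0)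
    (j : d) : ∀ k : d → ℤ, freqNormSq k < M →
      mFourierCoeff (EuclideanSpace.complexify ∘ partialDeriv j w) k = 0 := by
  intro k hk
  rw [mFourierCoeff_complexify_partialDeriv hw j k, h k hk, smul_zero]

/-- The cutoff is inherited by the Laplacian: `𝓕(Δw)(k) = −4π²|k|²·𝓕w(k)`. -/
theorem coeff_laplacian_eq_zero {w : UnitAddTorus d → EuclideanSpace ℝ d} (hw : IsSmooth w)
    {M : ℝ} (h : ∀ k : d → ℤ, freqNormSq k < M → mFourierCoeff (EuclideanSpace.complexify ∘ w) k = 0) :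
    ∀ k : d → ℤ, freqNormSq k < M →
      mFourierCoeff (EuclideanSpace.complexify ∘ laplacian w) k = 0 := by
  intro k hk
  rw [mFourierCoeff_complexify_laplacian hw k, h k hk, smul_zero, neg_zero]

/-- **Frequency-cutoff Poincaré, one derivative up: `4π²M‖∇w‖₂² ≤ ‖Δw‖₂²`.** -/
theorem gradNormSq_le_of_coeff_eq_zero {w : UnitAddTorus d → EuclideanSpace ℝ d}
    (hw : IsSmooth w) {M : ℝ} (hM : 0 ≤ M)
    (h : ∀ k : d → ℤ, freqNormSq k < M → mFourierCoeff (EuclideanSpace.complexify ∘ w) k = 0) :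
    4 * Real.pi ^ 2 * M * gradNormSq w ≤ ∫ x, ‖laplacian w x‖ ^ 2 := by
  have hj : ∀ j, 4 * Real.pi ^ 2 * M * ∫ x, ‖partialDeriv j w x‖ ^ 2 ≤ gradNormSq (partialDeriv j w) :=
    fun j => integral_norm_sq_le_of_coeff_eq_zero (hw.partialDeriv j) hM (coeff_partialDeriv_eq_zero hw h j)
  have hia : ∀ j, Integrable (fun x => ‖partialDeriv j w x‖ ^ 2) volume := fun j =>
    (((hw.partialDeriv j).continuous.norm).pow 2).integrable_of_hasCompactSupport
      (HasCompactSupport.of_compactSpace _)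
  have hE : gradNormSq w = ∑ j, ∫ x, ‖partialDeriv j w x‖ ^ 2 := by
    rw [gradNormSq, integral_finsetSum _ fun j _ => hia j]
  rw [hE, Finset.mul_sum, ← sum_gradNormSq_partialDeriv_eq hw]
  exact Finset.sum_le_sum fun j _ => hj j

/-- **Frequency-cutoff Poincaré, two derivatives up: `4π²M‖Δw‖₂² ≤ ‖∇Δw‖₂²`.** -/
theorem integral_norm_laplacian_sq_le_of_coeff_eq_zero {w : UnitAddTorus d → EuclideanSpace ℝ d}
    (hw : IsSmooth w) {M : ℝ} (hM : 0 ≤ M)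
    (h : ∀ k : d → ℤ, freqNormSq k < M → mFourierCoeff (EuclideanSpace.complexify ∘ w) k = 0) :
    4 * Real.pi ^ 2 * M * ∫ x, ‖laplacian w x‖ ^ 2 ≤ gradNormSq (laplacian w) :=
  integral_norm_sq_le_of_coeff_eq_zero hw.laplacian hM (coeff_laplacian_eq_zero hw h)

omit [DecidableEq d] in
/-- **Cube tail ⇒ frequency cutoff at `(K+1)²`.** If the Fourier coefficients of `w` vanish at every
`k` in the cube `|k|_∞ ≤ K` (i.e. unless some coordinate has `|kᵢ| ≥ K + 1`), then they vanish at every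
`k` with `|k|² < (K+1)²` — the hypothesis of the lemmas above with `M = (K+1)²`, the SHARP constant
for the cube-shell tails of the cell's certificates. -/
theorem coeff_eq_zero_of_cube_tail {w : UnitAddTorus d → EuclideanSpace ℝ d} {K : ℕ}
    (h : ∀ k : d → ℤ, (∀ i, |k i| ≤ (K : ℤ)) → mFourierCoeff (EuclideanSpace.complexify ∘ w) k = 0) :
    ∀ k : d → ℤ, freqNormSq k < ((K : ℝ) + 1) ^ 2 →
      mFourierCoeff (EuclideanSpace.complexify ∘ w) k = 0 := by
  intro k hk
  apply h k
  intro i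
  by_contra hi
  have hi' : (K : ℤ) + 1 ≤ |k i| := by
    rw [not_le] at hi; omega
  have hge := CubeShellAdjacency.sq_le_sum_sq_of_exists_abs_ge_real (k := k) (K := K) ⟨i, hi'⟩
  have e : ∑ j, ((k j : ℤ) : ℝ) ^ 2 = freqNormSq k := by rw [freqNormSq]
  rw [e] at hge
  exact absurd hk (not_lt.mpr hge)

end Summit.NavierStokesRegularity.FluidComputer.FrequencyCutoffPoincare
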